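import Summits.QuantumAdvantage.QuantumAdvantage.Theses.CubicForrelation
import Summits.QuantumAdvantage.QuantumAdvantage.Theorems.NearExactIsExact.Negative.F8ChainTwelve

/-!
# The Walsh-capacity method is exhausted at `15/16` on `12` bits (tightness witness for `isolation_twelve_15_16`)

Negative-side support for `NearExactIsExact` (stmt-QuantumAdvantage-14043; B2b-3 disprover seat `b2b-cforr-disprove`,
2026-08-18).  HONEST FRAMING: the value of this file is a CERTIFICATE (an exactly evaluated Walsh capacity of an explicit
cubic), not summit progress.

Every isolation bound at `n = 12` in this directory (`SmallCasesTwelve` `31/32`, `TypeOTwelve`/`NoCaseATwelve` `15/16`) is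
ONE-SIDED: it bounds `Φ(f,g) ≤ 2^{-18} Σ_x |W_g(x)|` (the Walsh capacity of `g`, `SmallCases.forrelation_le_cap`) and then
bounds the capacity of every non-bent cubic `g`.  This file shows that the capacity bound `15/16` of a non-bent `12`-bit
cubic is ATTAINED, by the nine-monomial cubic
`gP = x₀x₁ ⊕ x₂x₇ ⊕ x₃x₈ ⊕ x₄x₉ ⊕ x₅x₁₀ ⊕ x₆x₁₁ ⊕ x₀x₃x₁₁ ⊕ x₁x₄x₁₀ ⊕ x₅x₇x₈`
(inner product plus three cubes; Walsh spectrum `{0 (384×), ±64 (3584×), ±128 (128×)}`, so `Σ|W_gP| = 15·2^14 = (15/16)·2^18`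
and `gP` is not bent): `capacity_method_tight_twelve`.  Consequently NO argument that only uses the capacity of `g` can push the
`n = 12` isolation threshold below `15/16`; closing the remaining window `(57/64, 15/16]` (`F8ChainTwelve` gives `Φ = 57/64`)
needs two-sided information (the sign pattern of `W_g` against cubic `f`).  For the record, the soft Reed–Muller decoder's best
cubic partner of `gP` is `fP = x₀x₁ ⊕ x₂x₇ ⊕ x₃x₈ ⊕ x₄x₉ ⊕ x₅x₁₀ ⊕ x₆x₁₁ ⊕ x₂x₃x₁₀ ⊕ x₀x₅x₉ ⊕ x₁x₆x₈` with `Φ(fP, gP) = 45/64`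
(`forrelation_fP_gP`; no optimality is claimed).  `gP` was found in the "pencil" family
`g = α(z) ⊕ y₁y₁' ⊕ y₁'β(z) ⊕ y₁Q(z)` (whose capacity is the mean of the four `10`-bit capacities of `α ⊕ Q'β'`,
`Q' ∈ {Q, Q ⊕ 1}`, `β' ∈ {β, β ⊕ 1}`), searched by `kit/tight12.c` of the seat folder.

`native_decide` evaluates the fast Walsh–Hadamard transform `SmallCases.wal` of `SmallCasesWalsh.lean`: the file is
`computational`.  References: Carlet 2021 §6.1; Aaronson–Ambainis 2018 §1.1.1 (forrelation).
-/

set_option linter.dupNamespace false -- D-0017: single-problem summit ⇒ `QuantumAdvantage.QuantumAdvantage` by design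

namespace Summit.QuantumAdvantage.QuantumAdvantage.Theorems.NearExactIsExact.Negative.CapTight

open Finset
open Literature.Computability.QuantumComplexity
open Literature.Computability.QuantumComplexity.DerivativeWalsh (W)
open Summit.QuantumAdvantage.QuantumAdvantage.Theorems.SignedExactSliceIsLift.StubMoebius (isDegLeFun_xor)
open Summit.QuantumAdvantage.QuantumAdvantage.Theorems.NearExactIsExact.Negative.SmallCases
  (wal sigTable wspec pt sum_pt W_pt wal_sigTable length_wal sum_map_eq_sum_range fsumL forrelation_eq_fsumL)
open Summit.QuantumAdvantage.QuantumAdvantage.Theorems.NearExactIsExact.Negative.F8Chain (isDegLeFun_mon3 isDegLeFun_mon2)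

/-- `gP` = inner product `⊕ x₀x₃x₁₁ ⊕ x₁x₄x₁₀ ⊕ x₅x₇x₈` (nine monomials). [cite: Carlet2020, §6.1] -/
def gP (x : Fin (6 + 6) → Bool) : Bool :=
  xor
    (xor (xor (x 0 && (x 3 && x 11)) (x 1 && (x 4 && x 10))) (xor (x 5 && (x 7 && x 8)) (x 6 && x 11)))
    (xor (xor (x 5 && x 10) (x 4 && x 9)) (xor (x 3 && x 8) (xor (x 2 && x 7) (x 0 && x 1))))

/-- `fP` = inner product `⊕ x₂x₃x₁₀ ⊕ x₀x₅x₉ ⊕ x₁x₆x₈` (the decoder's best cubic partner of `gP`). [cite: Carlet2020, §6.1] -/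
def fP (x : Fin (6 + 6) → Bool) : Bool :=
  xor
    (xor (xor (x 2 && (x 3 && x 10)) (x 0 && (x 5 && x 9))) (xor (x 1 && (x 6 && x 8)) (x 6 && x 11)))
    (xor (xor (x 5 && x 10) (x 4 && x 9)) (xor (x 3 && x 8) (xor (x 2 && x 7) (x 0 && x 1))))

/-- `gP` is cubic. [cite: Carlet2020, §2.2.1 Def. 6] -/
theorem isDegLeFun_gP : IsDegLeFun 3 gP := by
  unfold gP
  repeat (first
    | exact isDegLeFun_mon3 _ _ _
    | exact isDegLeFun_mon2 _ _
    | apply isDegLeFun_xor)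

/-- `fP` is cubic. [cite: Carlet2020, §2.2.1 Def. 6] -/
theorem isDegLeFun_fP : IsDegLeFun 3 fP := by
  unfold fP
  repeat (first
    | exact isDegLeFun_mon3 _ _ _
    | exact isDegLeFun_mon2 _ _
    | apply isDegLeFun_xor)

/-- The Walsh capacity of `gP` on codes: `Σ_y |W_gP(y)| = 245760 = 15·2^14`. [folklore] -/
theorem capList_gP : ((wal (6 + 6) (sigTable (6 + 6) gP)).map Int.natAbs).sum = 245760 := by native_decide

/-- A Walsh zero of `gP` (code `581`). [folklore] -/
theorem walZero_gP : (wal (6 + 6) (sigTable (6 + 6) gP))[581]?.getD 0 = 0 := by native_decide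

/-- The capacity `Σ_y |wspec g y|` is the `natAbs`-sum of the fast Walsh transform of the signed table. [folklore] -/
theorem sum_abs_wspec_eq (n : ℕ) (g : (Fin n → Bool) → Bool) :
    ∑ y ∈ range (2 ^ n), |wspec n g y| = (((wal n (sigTable n g)).map Int.natAbs).sum : ℕ) := by
  have hlen : (wal n (sigTable n g)).length = 2 ^ n := length_wal _ _ (by simp [sigTable])
  rw [sum_map_eq_sum_range _ 0, hlen]
  push_cast
  refine sum_congr rfl fun y hy => ?_
  rw [← wal_sigTable _ _ _ (mem_range.1 hy), Int.abs_eq_natAbs]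

/-- `Σ_y |wspec gP y| = 245760`. [folklore] -/
theorem sum_abs_wspec_gP : ∑ y ∈ range (2 ^ (6 + 6)), |wspec (6 + 6) gP y| = 245760 := by
  have h := sum_abs_wspec_eq (6 + 6) gP
  rw [capList_gP] at h
  exact_mod_cast h

/-- `wspec gP 581 = 0`. [folklore] -/
theorem wspec_gP_zero : wspec (6 + 6) gP 581 = 0 := by
  have h := wal_sigTable (6 + 6) gP 581 (by norm_num)
  rw [walZero_gP] at h
  exact h.symm

/-- `W_gP` vanishes at the point with code `581`: `gP` is not bent. [folklore] -/
theorem W_gP_zero : W (fun y => signOf (gP y)) (pt (6 + 6) 581) = 0 := by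
  rw [W_pt, wspec_gP_zero]
  simp

/-- **`Σ_x |W_gP(x)| = (15/16)·2^18`.** [folklore] -/
theorem sum_abs_W_gP : ∑ x, |W (fun y => signOf (gP y)) x| = (15 / 16 : ℝ) * 2 ^ 18 := by
  rw [sum_pt]
  simp_rw [W_pt]
  have h : ∑ k ∈ range (2 ^ (6 + 6)), |(wspec (6 + 6) gP k : ℝ)| =
      ((∑ y ∈ range (2 ^ (6 + 6)), |wspec (6 + 6) gP y| : ℤ) : ℝ) := by
    push_cast
    rfl
  rw [h, sum_abs_wspec_gP]
  norm_num

/-- **The capacity method is tight at `15/16` on `12` bits**: a non-bent cubic whose Walsh capacity is exactly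
`(15/16)·2^18`, so `forrelation_le_cap` alone cannot certify any isolation threshold below `15/16` at `n = 12`. [folklore] -/
theorem capacity_method_tight_twelve :
    ∃ g : (Fin (6 + 6) → Bool) → Bool, IsDegLeFun 3 g ∧ (∃ x, W (fun y => signOf (g y)) x = 0) ∧
      ∑ x, |W (fun y => signOf (g y)) x| = (15 / 16 : ℝ) * 2 ^ 18 :=
  ⟨gP, isDegLeFun_gP, ⟨_, W_gP_zero⟩, sum_abs_W_gP⟩

/-- The forrelation sum of `(fP, gP)`: `45/64 · 2¹⁸ = 184320`. [folklore] -/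
theorem fsumL_fP_gP : fsumL (6 + 6) fP gP = 184320 := by native_decide

/-- `Φ(fP, gP) = 45/64` (the decoder's best partner; the capacity `15/16` of `gP` is not known to be attained). [folklore] -/
theorem forrelation_fP_gP : forrelation fP gP = 45 / 64 := by
  rw [forrelation_eq_fsumL 6 fP gP, fsumL_fP_gP]; norm_num

end Summit.QuantumAdvantage.QuantumAdvantage.Theorems.NearExactIsExact.Negative.CapTight
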